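import Literature.NumberTheory.Automorphic.SiegelReducedFamilies
import Mathlib.Algebra.Order.Chebyshev
import Mathlib.Algebra.QuadraticDiscriminant
import Mathlib.Analysis.Matrix.Hermitian
import HarnessLib

/-!
# Siegel-reduced families: real quadratic forms and the last-index block calculus

Topic `NumberTheory/Automorphic`; namespace `Literature.NumberTheory.Automorphic`, grouping
sub-namespace `SiegelFamily`.  First of three files proving the HULL LEMMA for the recursively
Siegel-reduced families of `SiegelReducedFamilies` (`…QuadForm` ⟶ `…Schur` ⟶ `…Hull`).  This
file fixes notation (four `abbrev`s: the real quadratic form `qf M y = re (yᴴ M y)`, the last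
column `lastCol`, the top-left block `topLeft`, the last pivot `lastRe`) and proves the
elementary facts about them:

* positive semidefiniteness and Loewner bounds `t · 1 − M ≥ 0` through `qf`
  (`posSemidef_iff_qf_nonneg`, `posSemidef_smul_one_sub_iff`), Cauchy–Schwarz for `uᴴ y`;
* the block expansion of `yᴴ M y` along the last index (`qf_snoc`), and its consequences for a
  positive semidefinite `E`: `‖(lastCol E)ᴴ z‖² ≤ E[m,m] · qf E♭ z`
  (`norm_sq_le_corner_mul_qf_topLeft`, by the discriminant of `r ↦ qf E (z, −r β)`), the Loewner
  bound on the top-left block, the corner and the last column.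

Everything is over `ℂ` with Mathlib's `Matrix.PosSemidef` (scoped `ComplexOrder`).

## References

* R. A. Horn, C. R. Johnson, *Matrix Analysis*, 2nd ed. (2013), §7.1, §7.7 (quadratic forms,
  Schur complements) — standard material. [folklore]
* A. Borel, *Introduction aux groupes arithmétiques*, Hermann (1969), §1, §12–§13 [Borel1969].
-/

noncomputable section

open scoped ComplexOrder Matrix ComplexConjugate
open Finset

namespace Literature.NumberTheory.Automorphic

namespace SiegelFamily

/-! ### Real quadratic forms of complex matrices -/

section QuadForm

variable {n : Type*} [Fintype n]

/-- The real quadratic form `y ↦ re (yᴴ M y)` of a complex square matrix. [folklore] -/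
abbrev qf (M : Matrix n n ℂ) (y : n → ℂ) : ℝ := (star y ⬝ᵥ (M *ᵥ y)).re

/-- `qf` is additive in the matrix. [folklore] -/
theorem qf_add (M N : Matrix n n ℂ) (y : n → ℂ) : qf (M + N) y = qf M y + qf N y := by
  simp [qf, Matrix.add_mulVec, dotProduct_add]

/-- `qf` is subtractive in the matrix. [folklore] -/
theorem qf_sub (M N : Matrix n n ℂ) (y : n → ℂ) : qf (M - N) y = qf M y - qf N y := by
  simp [qf, Matrix.sub_mulVec, dotProduct_sub]

/-- `qf` is homogeneous for real scalars. [folklore] -/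
theorem qf_smul (t : ℝ) (M : Matrix n n ℂ) (y : n → ℂ) : qf (t • M) y = t * qf M y := by
  simp only [qf, Matrix.smul_mulVec, dotProduct_smul, Complex.smul_re, smul_eq_mul]

/-- `qf` of a finite sum of matrices. [folklore] -/
theorem qf_sum {σ : Type*} (s : Finset σ) (M : σ → Matrix n n ℂ) (y : n → ℂ) :
    qf (∑ i ∈ s, M i) y = ∑ i ∈ s, qf (M i) y := by
  classical
  induction s using Finset.induction_on with
  | empty => simp [qf, Matrix.zero_mulVec]
  | insert a s ha ih => rw [sum_insert ha, sum_insert ha, qf_add, ih]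

/-- `qf 1 y = Σ ‖y i‖²`. [folklore] -/
theorem qf_one [DecidableEq n] (y : n → ℂ) : qf (1 : Matrix n n ℂ) y = ∑ i, ‖y i‖ ^ 2 := by
  simp only [qf, Matrix.one_mulVec, dotProduct, Pi.star_apply, Complex.star_def, Complex.re_sum]
  refine sum_congr rfl fun i _ => ?_
  rw [Complex.conj_mul', ← Complex.ofReal_pow, Complex.ofReal_re]

/-- `qf` of a rank-one matrix `u · uᴴ`: `re (yᴴ (u uᴴ) y) = ‖uᴴ y‖²`. [folklore] -/
theorem qf_vecMulVec_star (u y : n → ℂ) :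
    qf (Matrix.vecMulVec u (star u)) y = ‖star u ⬝ᵥ y‖ ^ 2 := by
  have h0 : star y ⬝ᵥ (Matrix.vecMulVec u (star u) *ᵥ y) = (star y ⬝ᵥ u) * (star u ⬝ᵥ y) := by
    simp only [dotProduct, Matrix.mulVec, Matrix.vecMulVec_apply, Pi.star_apply]
    rw [Finset.sum_mul_sum]
    refine sum_congr rfl fun i _ => ?_
    rw [Finset.mul_sum]
    refine sum_congr rfl fun j _ => ?_
    ring
  have h : star y ⬝ᵥ u = conj (star u ⬝ᵥ y) := by
    simp [dotProduct, map_sum, mul_comm]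
  rw [qf, h0, h, Complex.conj_mul', ← Complex.ofReal_pow, Complex.ofReal_re]

/-- For a Hermitian matrix the complex number `yᴴ M y` is real (Mathlib's
`IsHermitian.im_star_dotProduct_mulVec_self`, restated for `Complex.im`). [folklore] -/
theorem im_star_dotProduct_mulVec_of_isHermitian {M : Matrix n n ℂ} (hM : M.IsHermitian)
    (y : n → ℂ) : (star y ⬝ᵥ (M *ᵥ y)).im = 0 := by
  have h := hM.im_star_dotProduct_mulVec_self y
  rwa [RCLike.im_to_complex] at h

/-- `yᴴ M y = qf M y` as complex numbers, for `M` Hermitian. [folklore] -/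
theorem star_dotProduct_mulVec_eq_qf {M : Matrix n n ℂ} (hM : M.IsHermitian) (y : n → ℂ) :
    star y ⬝ᵥ (M *ᵥ y) = (qf M y : ℂ) :=
  Complex.ext (by simp [qf]) (by simp [im_star_dotProduct_mulVec_of_isHermitian hM y])

/-- **Positive semidefiniteness through the real quadratic form**: a Hermitian complex matrix is
positive semidefinite iff `re (yᴴ M y) ≥ 0` for all `y`. [folklore] -/
theorem posSemidef_iff_qf_nonneg {M : Matrix n n ℂ} (hM : M.IsHermitian) :
    M.PosSemidef ↔ ∀ y, 0 ≤ qf M y := by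
  rw [Matrix.posSemidef_iff_dotProduct_mulVec]
  constructor
  · intro h y
    have h' := h.2 y
    rw [star_dotProduct_mulVec_eq_qf hM] at h'
    exact_mod_cast h'
  · intro h
    refine ⟨hM, fun y => ?_⟩
    rw [star_dotProduct_mulVec_eq_qf hM]
    exact_mod_cast h y

/-- The real quadratic form of a positive semidefinite matrix is non-negative. [folklore] -/
theorem qf_nonneg_of_posSemidef {M : Matrix n n ℂ} (hM : M.PosSemidef) (y : n → ℂ) :
    0 ≤ qf M y :=
  (posSemidef_iff_qf_nonneg hM.1).1 hM y

/-- **Loewner bound through the quadratic form**: for `M` Hermitian and `t` real,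
`t · 1 − M` is positive semidefinite iff `qf M y ≤ t Σ ‖y i‖²` for all `y`. [folklore] -/
theorem posSemidef_smul_one_sub_iff [DecidableEq n] {M : Matrix n n ℂ} (hM : M.IsHermitian)
    (t : ℝ) : (t • (1 : Matrix n n ℂ) - M).PosSemidef ↔ ∀ y, qf M y ≤ t * ∑ i, ‖y i‖ ^ 2 := by
  have hH : (t • (1 : Matrix n n ℂ) - M).IsHermitian :=
    (Matrix.isHermitian_one.smul (IsSelfAdjoint.all t)).sub hM
  rw [posSemidef_iff_qf_nonneg hH]
  refine forall_congr' fun y => ?_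
  rw [qf_sub, qf_smul, qf_one, sub_nonneg]

/-- Monotonicity of the Loewner bound in the scalar. [folklore] -/
theorem posSemidef_smul_one_sub_mono [DecidableEq n] {M : Matrix n n ℂ} {t t' : ℝ} (htt' : t ≤ t')
    (h : (t • (1 : Matrix n n ℂ) - M).PosSemidef) : (t' • (1 : Matrix n n ℂ) - M).PosSemidef := by
  have hM : M.IsHermitian := by
    have h1 := h.1
    have h2 : (t • (1 : Matrix n n ℂ)).IsHermitian :=
      Matrix.isHermitian_one.smul (IsSelfAdjoint.all t)
    have : M = t • (1 : Matrix n n ℂ) - (t • (1 : Matrix n n ℂ) - M) := by abel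
    rw [this]
    exact h2.sub h1
  rw [posSemidef_smul_one_sub_iff hM] at h ⊢
  intro y
  exact (h y).trans (mul_le_mul_of_nonneg_right htt' (sum_nonneg fun i _ => sq_nonneg _))

/-- **Cauchy–Schwarz for `uᴴ y`**: `‖uᴴ y‖² ≤ (Σ ‖u i‖²) (Σ ‖y i‖²)`. [folklore] -/
theorem norm_star_dotProduct_sq_le (u y : n → ℂ) :
    ‖star u ⬝ᵥ y‖ ^ 2 ≤ (∑ i, ‖u i‖ ^ 2) * ∑ i, ‖y i‖ ^ 2 := by
  have h1 : ‖star u ⬝ᵥ y‖ ≤ ∑ i, ‖u i‖ * ‖y i‖ := by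
    refine (norm_sum_le _ _).trans (le_of_eq (sum_congr rfl fun i _ => ?_))
    simp
  have h2 : (∑ i, ‖u i‖ * ‖y i‖) ^ 2 ≤ (∑ i, ‖u i‖ ^ 2) * ∑ i, ‖y i‖ ^ 2 :=
    sum_mul_sq_le_sq_mul_sq _ _ _
  exact (pow_le_pow_left₀ (norm_nonneg _) h1 2).trans h2

end QuadForm

/-! ### Peeling the last index: block formulas for `(m+1) × (m+1)` matrices -/

section Block

variable {m : ℕ}

/-- The last column (above the corner) of an `(m+1) × (m+1)` matrix. [folklore] -/
abbrev lastCol (M : Matrix (Fin (m + 1)) (Fin (m + 1)) ℂ) : Fin m → ℂ :=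
  fun j => M j.castSucc (Fin.last m)

/-- The top-left `m × m` block of an `(m+1) × (m+1)` matrix. [folklore] -/
abbrev topLeft (M : Matrix (Fin (m + 1)) (Fin (m + 1)) ℂ) : Matrix (Fin m) (Fin m) ℂ :=
  M.submatrix Fin.castSucc Fin.castSucc

/-- **Block expansion of `yᴴ M y` along the last index** for `y = (z, s)`. [folklore] -/
theorem star_snoc_dotProduct_mulVec_snoc (M : Matrix (Fin (m + 1)) (Fin (m + 1)) ℂ)
    (z : Fin m → ℂ) (s : ℂ) :
    star (Fin.snoc z s : Fin (m + 1) → ℂ) ⬝ᵥ (M *ᵥ (Fin.snoc z s : Fin (m + 1) → ℂ)) =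
      star z ⬝ᵥ (topLeft M *ᵥ z) + (star z ⬝ᵥ lastCol M) * s +
        conj s * ((fun j => M (Fin.last m) j.castSucc) ⬝ᵥ z) +
        conj s * M (Fin.last m) (Fin.last m) * s := by
  simp only [dotProduct, Matrix.mulVec, Fin.sum_univ_castSucc, Fin.snoc_castSucc, Fin.snoc_last,
    Pi.star_apply, Matrix.submatrix_apply, Complex.star_def, lastCol, topLeft]
  simp only [mul_add, Finset.sum_add_distrib, Finset.sum_mul, mul_assoc]
  ring

/-- For a Hermitian matrix the last row is the conjugate of the last column. [folklore] -/
theorem lastRow_eq_star_lastCol {M : Matrix (Fin (m + 1)) (Fin (m + 1)) ℂ} (hM : M.IsHermitian) :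
    (fun j => M (Fin.last m) j.castSucc) = star (lastCol M) := by
  funext j
  simp only [Pi.star_apply, Complex.star_def]
  exact (hM.apply (Fin.last m) j.castSucc).symm

/-- **`qf` along the last index for a Hermitian matrix**: with `a = M[m,m]` (real) and
`β = (lastCol M)ᴴ z`, `qf M (z, s) = qf M♭ z + 2 re (s̄ β) + a ‖s‖²`. [folklore] -/
theorem qf_snoc {M : Matrix (Fin (m + 1)) (Fin (m + 1)) ℂ} (hM : M.IsHermitian) (z : Fin m → ℂ)
    (s : ℂ) :
    qf M (Fin.snoc z s) = qf (topLeft M) z + 2 * (conj s * (star (lastCol M) ⬝ᵥ z)).re +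
      (M (Fin.last m) (Fin.last m)).re * ‖s‖ ^ 2 := by
  have hβ : star z ⬝ᵥ lastCol M = conj (star (lastCol M) ⬝ᵥ z) := by
    simp [dotProduct, map_sum, mul_comm]
  have ha : M (Fin.last m) (Fin.last m) = ((M (Fin.last m) (Fin.last m)).re : ℂ) :=
    (hM.coe_re_apply_self (Fin.last m)).symm
  rw [qf, star_snoc_dotProduct_mulVec_snoc, lastRow_eq_star_lastCol hM, hβ]
  set β := star (lastCol M) ⬝ᵥ z
  have h3 : (conj s * M (Fin.last m) (Fin.last m) * s).re =
      (M (Fin.last m) (Fin.last m)).re * ‖s‖ ^ 2 := by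
    rw [ha, Complex.sq_norm, Complex.normSq_apply]
    simp only [Complex.mul_re, Complex.mul_im, Complex.conj_re, Complex.conj_im, Complex.ofReal_re,
      Complex.ofReal_im]
    ring
  have h2 : (conj β * s).re = (conj s * β).re := by
    simp only [Complex.mul_re, Complex.conj_re, Complex.conj_im]
    ring
  simp only [Complex.add_re, qf]
  rw [h3, h2]
  ring

/-- **Positivity on the last index controls the mixed term**: for `E` positive semidefinite,
`‖(lastCol E)ᴴ z‖² ≤ E[m,m] · qf E♭ z`. [folklore] -/
theorem norm_sq_le_corner_mul_qf_topLeft {E : Matrix (Fin (m + 1)) (Fin (m + 1)) ℂ}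
    (hE : E.PosSemidef) (z : Fin m → ℂ) :
    ‖star (lastCol E) ⬝ᵥ z‖ ^ 2 ≤ (E (Fin.last m) (Fin.last m)).re * qf (topLeft E) z := by
  set β := star (lastCol E) ⬝ᵥ z with hβ
  set e := (E (Fin.last m) (Fin.last m)).re with he
  set q := qf (topLeft E) z with hq
  -- `r ↦ qf E (z, -r β) = e ‖β‖² r² − 2 ‖β‖² r + q ≥ 0`
  have hquad : ∀ r : ℝ, 0 ≤ (e * ‖β‖ ^ 2) * (r * r) + (-(2 * ‖β‖ ^ 2)) * r + q := by
    intro r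
    have h0 := qf_nonneg_of_posSemidef hE (Fin.snoc z (-(r : ℂ) * β))
    rw [qf_snoc hE.1] at h0
    have h1 : (conj (-(r : ℂ) * β) * (star (lastCol E) ⬝ᵥ z)).re = -(r * ‖β‖ ^ 2) := by
      rw [← hβ, map_mul, map_neg, Complex.conj_ofReal, neg_mul, neg_mul, Complex.neg_re, mul_assoc,
        Complex.re_ofReal_mul, Complex.conj_mul', ← Complex.ofReal_pow, Complex.ofReal_re]
    have h2 : ‖-(r : ℂ) * β‖ ^ 2 = r * r * ‖β‖ ^ 2 := by
      rw [norm_mul, norm_neg, Complex.norm_real, Real.norm_eq_abs, mul_pow, sq_abs]; ring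
    rw [h1, h2] at h0
    have : qf (topLeft E) z + 2 * -(r * ‖β‖ ^ 2) + (E (Fin.last m) (Fin.last m)).re * (r * r * ‖β‖ ^ 2)
        = (e * ‖β‖ ^ 2) * (r * r) + (-(2 * ‖β‖ ^ 2)) * r + q := by rw [he, hq]; ring
    linarith [h0, this.le, this.ge]
  have hdisc := discrim_le_zero hquad
  rw [discrim] at hdisc
  -- `(2‖β‖²)² ≤ 4 e ‖β‖² q`
  have h4 : ‖β‖ ^ 2 * ‖β‖ ^ 2 ≤ ‖β‖ ^ 2 * (e * q) := by nlinarith [hdisc]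
  by_cases hb : ‖β‖ ^ 2 = 0
  · rw [hb]
    have he0 : 0 ≤ e := by
      have := hE.diag_nonneg (i := Fin.last m)
      rw [he]; exact (Complex.nonneg_iff.1 this).1
    exact mul_nonneg he0 (qf_nonneg_of_posSemidef (hE.submatrix Fin.castSucc) z)
  · have hpos : 0 < ‖β‖ ^ 2 := lt_of_le_of_ne (sq_nonneg _) (Ne.symm hb)
    exact le_of_mul_le_mul_left h4 hpos

/-- The top-left block inherits a Loewner bound: if `t · 1 − E ≥ 0` then `qf E♭ z ≤ t Σ ‖z j‖²`.
[folklore] -/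
theorem qf_topLeft_le {E : Matrix (Fin (m + 1)) (Fin (m + 1)) ℂ} (hE : E.IsHermitian) {t : ℝ}
    (ht : (t • (1 : Matrix (Fin (m + 1)) (Fin (m + 1)) ℂ) - E).PosSemidef) (z : Fin m → ℂ) :
    qf (topLeft E) z ≤ t * ∑ j, ‖z j‖ ^ 2 := by
  classical
  have h := (posSemidef_smul_one_sub_iff hE t).1 ht (Fin.snoc z 0)
  rw [qf_snoc hE] at h
  simpa [Fin.sum_univ_castSucc] using h

/-- Diagonal entries under a Loewner bound: `0 ≤ E[m,m] ≤ t`. [folklore] -/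
theorem corner_re_le {E : Matrix (Fin (m + 1)) (Fin (m + 1)) ℂ} (hE : E.PosSemidef) {t : ℝ}
    (ht : (t • (1 : Matrix (Fin (m + 1)) (Fin (m + 1)) ℂ) - E).PosSemidef) :
    0 ≤ (E (Fin.last m) (Fin.last m)).re ∧ (E (Fin.last m) (Fin.last m)).re ≤ t := by
  classical
  constructor
  · exact (Complex.nonneg_iff.1 (hE.diag_nonneg (i := Fin.last m))).1
  · have h := ht.diag_nonneg (i := Fin.last m)
    have h' := (Complex.nonneg_iff.1 h).1
    simp only [Matrix.sub_apply, Matrix.smul_apply, Matrix.one_apply_eq, Complex.sub_re,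
      Complex.real_smul, mul_one, Complex.ofReal_re] at h'
    linarith

/-- Entries of the last column under a Loewner bound: `‖E[j,m]‖ ≤ t`. [folklore] -/
theorem norm_lastCol_le {E : Matrix (Fin (m + 1)) (Fin (m + 1)) ℂ} (hE : E.PosSemidef) {t : ℝ}
    (ht : (t • (1 : Matrix (Fin (m + 1)) (Fin (m + 1)) ℂ) - E).PosSemidef) (j : Fin m) :
    ‖E j.castSucc (Fin.last m)‖ ≤ t := by
  classical
  obtain ⟨he0, het⟩ := corner_re_le hE ht
  have ht0 : 0 ≤ t := he0.trans het
  -- `‖(lastCol E)ᴴ e_j‖ = ‖E[j,m]‖` and `qf E♭ e_j = E[j,j] ≤ t`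
  have h := norm_sq_le_corner_mul_qf_topLeft hE (Pi.single j 1)
  have hβ : star (lastCol E) ⬝ᵥ (Pi.single j 1 : Fin m → ℂ) = conj (E j.castSucc (Fin.last m)) := by
    simp [dotProduct, Pi.single_apply, lastCol]
  have hs : ∑ x : Fin m, ‖(Pi.single j (1 : ℂ) : Fin m → ℂ) x‖ ^ 2 = 1 := by
    rw [Fintype.sum_eq_single j]
    · simp
    · intro x hx; simp [hx]
  have hq : qf (topLeft E) (Pi.single j 1) ≤ t * 1 := by
    have := qf_topLeft_le hE.1 ht (Pi.single j 1 : Fin m → ℂ)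
    rwa [hs] at this
  rw [hβ, Complex.norm_conj] at h
  have h2 : ‖E j.castSucc (Fin.last m)‖ ^ 2 ≤ t * t := by
    refine h.trans ?_
    calc (E (Fin.last m) (Fin.last m)).re * qf (topLeft E) (Pi.single j 1)
        ≤ t * qf (topLeft E) (Pi.single j 1) :=
          mul_le_mul_of_nonneg_right het (qf_nonneg_of_posSemidef (hE.submatrix _) _)
      _ ≤ t * (t * 1) := mul_le_mul_of_nonneg_left hq ht0
      _ = t * t := by ring
  nlinarith [norm_nonneg (E j.castSucc (Fin.last m)), h2]

end Block

/-! ### The last pivot -/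

section LastRe

/-- The last pivot of a square matrix (`0` in size `0`). [folklore] -/
abbrev lastRe : {m : ℕ} → Matrix (Fin m) (Fin m) ℂ → ℝ
  | 0, _ => 0
  | _ + 1, M => (M (Fin.last _) (Fin.last _)).re

/-- `lastRe` in positive size is the real part of the corner. [folklore] -/
@[simp]
theorem lastRe_succ {m : ℕ} (M : Matrix (Fin (m + 1)) (Fin (m + 1)) ℂ) :
    lastRe M = (M (Fin.last m) (Fin.last m)).re :=
  rfl

end LastRe

end SiegelFamily

end Literature.NumberTheory.Automorphic
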